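import Mathlib
import Summits.ValiantsHypothesis.ValiantsHypothesis.Theses.NewtonUnitEquations
import Summits.ValiantsHypothesis.ValiantsHypothesis.Theorems.NewtonUnitEquationsDissociatedUniformQuasiPoly
import Summits.ValiantsHypothesis.ValiantsHypothesis.Theorems.NewtonUnitEquationsDissociatedUniformOfKLetterFrame

/-!
# Line `dissociated-weak` — LADDER-DOWN on crux `NewtonUnitEquations.FewProductsBound` (stmt-ValiantsHypothesis-16052)

Forward generator G4 (unit fwd-ladder-ValiantsHypothesis-52).  The crux (KPTT few-products form, ⟺ `NewtonTauWeak` by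
p117728, ⟹ `ValiantsHypothesis` through `KpttTransfer`):
`FewProductsBound : ∃ a b, ∀ k m t f, k ≤ 2^m → (f i j t-sparse) → #vert Newt(Σ_{i<k} Π_{j<m} f i j) ≤ 2^(a m) (t+2)^b`.

GRADED FAMILY in the crux's own language (`DRung κ`): the same bound ON DISSOCIATED FRAMES (`supp f i j ⊆ A j`,
`|A j| ≤ t`, the sum map `Π_j A j → ℕ²` injective — the frame language of the sibling crux `DissociatedUniform`,
stmt-5905), graded by the UNIFORMITY RANGE `k ≤ 2^(κ m)`.
* FLOOR (theorem, `dRung_floor`): `κ₀ m = m / (⌈log₂ m⌉ + 1)` — Theorem Q (`dissociated_quasiPoly`, p94717: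
  `#vert ≤ (t+2)(8(k+2)³)^⌈log₂ m⌉`) is `≤ 2^(12 m)(t+2)` in that range.  (Also proved, weaker: constant `κ` by
  `DissociatedFixedK`, stmt-5907.)
* RUNG (open, THIS LINE): `κ = id`, `DissociatedFewProducts` — the first open dissociated statement in the WEAK
  envelope; implied by the crux (`dfp_of_fewProductsBound`, drop the frame) and by `DissociatedUniform`
  (`dfp_of_dissociatedUniform`); equivalent to its alphabet-reduced KERNEL `KLetterWeak` (`t := k`; the converse
  `dfp_of_kLetterWeak` is PROVED here from the landed covering family `stub_coveringFamily` + `extremePoints_subset_cover`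
  of the alphabet reduction p88821, with weak arithmetic).  Gap to close on the rung: Theorem Q gives `2^O(m log m)`,
  the rung asks `2^O(m)` — "log m → O(1)" in the exponent, i.e. the design kernel of 5905 in the regime
  `log k ≍ m` only (5905's registered kernel `stub_smallShadow` asks poly(k) on `≤ 4k²` coordinates; this asks
  `2^O(n) poly(k)` on `n` coordinates — strictly weaker).
* TOP: the crux = the rung with the dissociation hypothesis removed; `stub_collisionTransfer` is the LIMIT STEP
  (coincidences / cancellation inside subset-sum fibres; KPTT name cancellation "the main difficulty"; no mechanism is
  claimed — for coefficient-free weighted LEVEL SETS dissociation is free, `stub_refineDissociate` of line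
  `binomial-normal-form` of crux 5904, which is where a mechanism would come from).

REGISTERED STUBS: `stub_kLetterWeak` (the rung's kernel, load-bearing, open) and `stub_collisionTransfer` (limit step,
open, hard).  Composition `FewProductsBound_of : KLetterWeak → (DissociatedFewProducts → FewProductsBound) →
FewProductsBound` (no sorry) and `FewProductsBound_of_stubs`.  Sorries: exactly the two stubs.
Probes (folder bc/DFP_probe.lean, all by `first | exact? | simpa | aesop`, 400k heartbeats): rung → crux FAIL,
rung → summit FAIL, kernel → crux FAIL, kernel → summit FAIL, floor → rung FAIL (real step), summit → rung FAIL,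
rung / kernel outright FAIL; crux → rung SUCCEEDS (`dfp_of_fewProductsBound`).  `#h21_crux_probe` on the rung and
the kernel: VERDICT CLEAN (bc/DFP_cruxprobe.lean).
Disproof used: none exists for this crux (`Cruxes/FewProductsBound/` was empty); the 5904 Disproof / census r1
N-L ("a dissociated counterexample to NewtonTauWeak needs k ≥ 2^(m/log m)") is exactly the floor theorem's range.
-/

set_option linter.dupNamespace false

namespace Summit.ValiantsHypothesis.ValiantsHypothesis.Cruxes.FewProductsBound.DissociatedWeak

open scoped BigOperators
open Summit.ValiantsHypothesis.ValiantsHypothesis.Theses.NewtonUnitEquations (FewProductsBound DissociatedUniform)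
open Summit.ValiantsHypothesis.ValiantsHypothesis.Theorems.NewtonUnitEquationsDissociatedUniform

/-- The graded rung `DRung κ`: on DISSOCIATED frames (`supp f i j ⊆ A j`, `|A j| ≤ t`, the sum map `Π_j A j → ℕ²`
injective) with `k ≤ 2 ^ κ m` products of `m` factors, `#vert Newt(Σ_i Π_j f i j) ≤ 2^(a m) (t+2)^b`. -/
def DRung (κ : ℕ → ℕ) : Prop :=
  ∃ a b : ℕ, ∀ (k m t : ℕ) (A : Fin m → Finset (Fin 2 →₀ ℕ)) (f : Fin k → Fin m → MvPolynomial (Fin 2) ℂ),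
    k ≤ 2 ^ κ m → (∀ j, (A j).card ≤ t) → (∀ i j, (f i j).support ⊆ A j) →
    (∀ a b : Fin m → (Fin 2 →₀ ℕ), (∀ j, a j ∈ A j) → (∀ j, b j ∈ A j) → ∑ j, a j = ∑ j, b j → a = b) →
    (Set.extremePoints ℝ (convexHull ℝ ((fun e : Fin 2 →₀ ℕ => fun i : Fin 2 => ((e i : ℕ) : ℝ)) ''
      ((∑ i, ∏ j, f i j).support : Set (Fin 2 →₀ ℕ))))).ncard ≤ 2 ^ (a * m) * (t + 2) ^ b

/-- THE RUNG `DissociatedFewProducts` (= `DRung id`): the crux `FewProductsBound` restricted to dissociated frames. -/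
def DissociatedFewProducts : Prop :=
  ∃ a b : ℕ, ∀ (k m t : ℕ) (A : Fin m → Finset (Fin 2 →₀ ℕ)) (f : Fin k → Fin m → MvPolynomial (Fin 2) ℂ),
    k ≤ 2 ^ m → (∀ j, (A j).card ≤ t) → (∀ i j, (f i j).support ⊆ A j) →
    (∀ a b : Fin m → (Fin 2 →₀ ℕ), (∀ j, a j ∈ A j) → (∀ j, b j ∈ A j) → ∑ j, a j = ∑ j, b j → a = b) →
    (Set.extremePoints ℝ (convexHull ℝ ((fun e : Fin 2 →₀ ℕ => fun i : Fin 2 => ((e i : ℕ) : ℝ)) ''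
      ((∑ i, ∏ j, f i j).support : Set (Fin 2 →₀ ℕ))))).ncard ≤ 2 ^ (a * m) * (t + 2) ^ b

/-- The KERNEL of the rung (alphabet-reduced, `t := k`): dissociated frames with `≤ k` letters per coordinate and
`k ≤ 2^m` products have `≤ 2^(a m) (k+2)^b` vertices. -/
def KLetterWeak : Prop :=
  ∃ a b : ℕ, ∀ (k m : ℕ) (A : Fin m → Finset (Fin 2 →₀ ℕ)) (f : Fin k → Fin m → MvPolynomial (Fin 2) ℂ),
    k ≤ 2 ^ m → (∀ j, (A j).card ≤ k) → (∀ i j, (f i j).support ⊆ A j) →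
    (∀ a b : Fin m → (Fin 2 →₀ ℕ), (∀ j, a j ∈ A j) → (∀ j, b j ∈ A j) → ∑ j, a j = ∑ j, b j → a = b) →
    (Set.extremePoints ℝ (convexHull ℝ ((fun e : Fin 2 →₀ ℕ => fun i : Fin 2 => ((e i : ℕ) : ℝ)) ''
      ((∑ i, ∏ j, f i j).support : Set (Fin 2 →₀ ℕ))))).ncard ≤ 2 ^ (a * m) * (k + 2) ^ b

theorem dissociatedFewProducts_iff_dRung_id : DissociatedFewProducts ↔ DRung id := Iff.rfl

/-! ## On-path: the crux implies the rung, and so does the sibling crux `DissociatedUniform` -/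

/-- `FewProductsBound → DissociatedFewProducts` (drop the frame). -/
theorem dfp_of_fewProductsBound (h : FewProductsBound) : DissociatedFewProducts := by
  obtain ⟨a, b, h⟩ := h
  refine ⟨a, b, fun k m t A f hk hcard hsupp hdis => h k m t f hk fun i j => ?_⟩
  exact (Finset.card_le_card (hsupp i j)).trans (hcard j)

/-- Arithmetic: `k ≤ 2^m → k·m·t + 2 ≤ 2^(2m) (t+2)`. -/
theorem base_le (k m t : ℕ) (hk : k ≤ 2 ^ m) : k * m * t + 2 ≤ 2 ^ (2 * m) * (t + 2) := by
  have hm : m ≤ 2 ^ m := Nat.lt_two_pow_self.le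
  have hkm : k * m ≤ 2 ^ (2 * m) := by
    calc k * m ≤ 2 ^ m * 2 ^ m := Nat.mul_le_mul hk hm
      _ = 2 ^ (2 * m) := by rw [← pow_add, two_mul]
  have h1 : k * m * t ≤ 2 ^ (2 * m) * t := Nat.mul_le_mul_right t hkm
  have h2 : 1 ≤ 2 ^ (2 * m) := Nat.one_le_two_pow
  rw [Nat.mul_add]
  omega

/-- `DissociatedUniform → DissociatedFewProducts` (`(kmt+2)^C ≤ 2^(2Cm) (t+2)^C` for `k ≤ 2^m`). -/
theorem dfp_of_dissociatedUniform (h : DissociatedUniform) : DissociatedFewProducts := by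
  obtain ⟨C, h⟩ := h
  refine ⟨2 * C, C, fun k m t A f hk hcard hsupp hdis => ?_⟩
  calc _ ≤ (k * m * t + 2) ^ C := h k m t A f hcard hsupp hdis
    _ ≤ (2 ^ (2 * m) * (t + 2)) ^ C := Nat.pow_le_pow_left (base_le k m t hk) C
    _ = 2 ^ (2 * C * m) * (t + 2) ^ C := by rw [mul_pow, ← pow_mul, show 2 * m * C = 2 * C * m by ring]

/-! ## The floor: `DRung (m ↦ m / (⌈log₂ m⌉ + 1))` is Theorem Q -/

/-- Arithmetic of the Khatri–Rao factor: `k ≤ 2^q → (8 (k+2)³)^c ≤ 2^((3q+9) c)`. -/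
theorem khatriRao_factor_le (k q c : ℕ) (hk : k ≤ 2 ^ q) : (8 * (k + 2) ^ 3) ^ c ≤ 2 ^ ((3 * q + 9) * c) := by
  have hP : 1 ≤ 2 ^ q := Nat.one_le_two_pow
  have h1 : k + 2 ≤ 2 ^ (q + 2) := by
    have : 2 ^ (q + 2) = 2 ^ q * 4 := by rw [pow_add]; norm_num
    omega
  have h2 : 8 * (k + 2) ^ 3 ≤ 2 ^ (3 * q + 9) := by
    calc 8 * (k + 2) ^ 3 ≤ 8 * (2 ^ (q + 2)) ^ 3 := Nat.mul_le_mul_left _ (Nat.pow_le_pow_left h1 3)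
      _ = 2 ^ (3 * q + 9) := by ring
  calc (8 * (k + 2) ^ 3) ^ c ≤ (2 ^ (3 * q + 9)) ^ c := Nat.pow_le_pow_left h2 c
    _ = 2 ^ ((3 * q + 9) * c) := by rw [← pow_mul]

/-- **Floor (PROVED).**  In the uniformity range `k ≤ 2^(m / (⌈log₂ m⌉ + 1))` the dissociated few-products bound holds
with `a = 12`, `b = 1`: Theorem Q's `(t+2)(8(k+2)³)^⌈log₂ m⌉` is then `≤ 2^(12 m) (t + 2)`. -/
theorem dRung_floor : DRung (fun m => m / (Nat.clog 2 m + 1)) := by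
  refine ⟨12, 1, ?_⟩
  intro k m t A f hk hcard hsupp hdis
  change k ≤ 2 ^ (m / (Nat.clog 2 m + 1)) at hk
  have hQ := dissociated_quasiPoly k m t A f hcard hsupp hdis
  set c := Nat.clog 2 m with hc
  have hfac := khatriRao_factor_le k (m / (c + 1)) c hk
  have hqc : (m / (c + 1)) * c ≤ m :=
    calc (m / (c + 1)) * c ≤ (m / (c + 1)) * (c + 1) := Nat.mul_le_mul_left _ (Nat.le_succ c)
      _ ≤ m := Nat.div_mul_le_self m (c + 1)
  have hcm : c ≤ m := (Nat.clog_le_iff_le_pow one_lt_two).mpr Nat.lt_two_pow_self.le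
  have hexp : (3 * (m / (c + 1)) + 9) * c ≤ 12 * m := by
    have h3 := Nat.mul_le_mul_left 3 hqc
    have h9 := Nat.mul_le_mul_left 9 hcm
    calc (3 * (m / (c + 1)) + 9) * c = 3 * ((m / (c + 1)) * c) + 9 * c := by ring
      _ ≤ 3 * m + 9 * m := Nat.add_le_add h3 h9
      _ = 12 * m := by ring
  calc _ ≤ (t + 2) * (8 * (k + 2) ^ 3) ^ c := hQ
    _ ≤ (t + 2) * 2 ^ ((3 * (m / (c + 1)) + 9) * c) := Nat.mul_le_mul_left _ hfac
    _ ≤ (t + 2) * 2 ^ (12 * m) := Nat.mul_le_mul_left _ (Nat.pow_le_pow_right (by norm_num) hexp)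
    _ = 2 ^ (12 * m) * (t + 2) ^ 1 := by ring

/-- Monotonicity of the ladder in the uniformity range. -/
theorem dRung_mono {κ κ' : ℕ → ℕ} (hκ : ∀ m, κ m ≤ κ' m) (h : DRung κ') : DRung κ := by
  obtain ⟨a, b, h⟩ := h
  exact ⟨a, b, fun k m t A f hk hcard hsupp hdis =>
    h k m t A f (hk.trans (Nat.pow_le_pow_right (by norm_num) (hκ m))) hcard hsupp hdis⟩

/-! ## The kernel form: `KLetterWeak ↔ DissociatedFewProducts` (alphabet reduction `t ↦ k`, weak arithmetic) -/

/-- `DissociatedFewProducts → KLetterWeak` (`t := k`). -/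
theorem kLetterWeak_of_dfp (h : DissociatedFewProducts) : KLetterWeak := by
  obtain ⟨a, b, h⟩ := h
  exact ⟨a, b, fun k m A f hk hcard hsupp hdis => h k m k A f hk hcard hsupp hdis⟩

open OfKLetterFrame in
/-- Counting over a covering family of sub-boxes with an ARBITRARY per-box bound `Q` (the counting step of the landed
alphabet reduction `dissociatedUniform_of_kLetterFrame`, p88821, with the bound abstracted). -/
theorem ncard_le_of_cover {k m Q : ℕ}
    (hD : ∀ (B : Fin m → Finset (Fin 2 →₀ ℕ)) (g : Fin k → Fin m → MvPolynomial (Fin 2) ℂ),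
      (∀ j, (B j).card ≤ k) → (∀ i j, (g i j).support ⊆ B j) →
      (∀ a b : Fin m → (Fin 2 →₀ ℕ), (∀ j, a j ∈ B j) → (∀ j, b j ∈ B j) → ∑ j, a j = ∑ j, b j → a = b) →
      (Set.extremePoints ℝ (convexHull ℝ ((fun e : Fin 2 →₀ ℕ => fun i : Fin 2 => ((e i : ℕ) : ℝ)) ''
        ((∑ i, ∏ j, g i j).support : Set (Fin 2 →₀ ℕ))))).ncard ≤ Q)
    {A : Fin m → Finset (Fin 2 →₀ ℕ)} {f : Fin k → Fin m → MvPolynomial (Fin 2) ℂ}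
    (hdis : ∀ a b : Fin m → (Fin 2 →₀ ℕ), (∀ j, a j ∈ A j) → (∀ j, b j ∈ A j) → ∑ j, a j = ∑ j, b j → a = b)
    {𝔅 : Finset (Fin m → Finset (Fin 2 →₀ ℕ))} (h𝔅 : ∀ B ∈ 𝔅, (∀ j, B j ⊆ A j) ∧ ∀ j, (B j).card ≤ k)
    {E : Set (Fin 2 → ℝ)}
    (hE : E ⊆ ⋃ B ∈ 𝔅, Set.extremePoints ℝ (convexHull ℝ ((fun e : Fin 2 →₀ ℕ => fun i : Fin 2 => ((e i : ℕ) : ℝ)) ''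
          ((∑ i, ∏ j, restrictTo (B j) (f i j)).support : Set (Fin 2 →₀ ℕ))))) :
    E.ncard ≤ 𝔅.card * Q := by
  classical
  set V : (Fin m → Finset (Fin 2 →₀ ℕ)) → Set (Fin 2 → ℝ) := fun B =>
    Set.extremePoints ℝ (convexHull ℝ ((fun e : Fin 2 →₀ ℕ => fun i : Fin 2 => ((e i : ℕ) : ℝ)) ''
      ((∑ i, ∏ j, restrictTo (B j) (f i j)).support : Set (Fin 2 →₀ ℕ)))) with hV
  have hfin : ∀ B ∈ 𝔅, (V B).Finite := fun B _ =>
    (Set.Finite.image _ (Finset.finite_toSet _)).subset extremePoints_convexHull_subset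
  have hUfin : (⋃ B ∈ 𝔅, V B).Finite := Set.Finite.biUnion (Finset.finite_toSet 𝔅) hfin
  calc E.ncard ≤ (⋃ B ∈ 𝔅, V B).ncard := Set.ncard_le_ncard hE hUfin
    _ ≤ ∑ B ∈ 𝔅, (V B).ncard := Finset.set_ncard_biUnion_le 𝔅 _
    _ ≤ ∑ B ∈ 𝔅, Q := by
        refine Finset.sum_le_sum fun B hB => ?_
        exact hD B (fun i j => restrictTo (B j) (f i j)) (h𝔅 B hB).2 (fun i j => support_restrictTo _ _)
          (dissociated_mono hdis (h𝔅 B hB).1)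
    _ = 𝔅.card * Q := by rw [Finset.sum_const, smul_eq_mul]

/-- **Kernel reduction (PROVED): `KLetterWeak → DissociatedFewProducts`.**  The covering family of `≤ (kmt+2)^c`
admissible `k`-letter sub-boxes (`stub_coveringFamily`, landed) captures every vertex (`extremePoints_subset_cover`);
on each sub-box the kernel gives `2^(am)(k+2)^b`, and `k ≤ 2^m` makes `(kmt+2)^c (k+2)^b ≤ 2^((2c+b)m) (t+2)^(c+2b)`. -/
theorem dfp_of_kLetterWeak (h : KLetterWeak) : DissociatedFewProducts := by
  classical
  obtain ⟨a, b, hK⟩ := h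
  obtain ⟨c, hC⟩ := stub_coveringFamily
  refine ⟨2 * c + a + b, c + 2 * b, fun k m t A f hk hcard hsupp hdis => ?_⟩
  obtain ⟨𝔅, h𝔅card, h𝔅adm, hcover⟩ := hC k m t A f hcard hdis
  have h1 := OfKLetterFrame.extremePoints_subset_cover hsupp hdis h𝔅adm hcover
  have h2 := ncard_le_of_cover (Q := 2 ^ (a * m) * (k + 2) ^ b)
    (fun B g hB hsuppB hdisB => hK k m B g hk hB hsuppB hdisB) hdis h𝔅adm h1
  have hB : 𝔅.card ≤ 2 ^ (2 * c * m) * (t + 2) ^ c :=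
    h𝔅card.trans (by
      calc (k * m * t + 2) ^ c ≤ (2 ^ (2 * m) * (t + 2)) ^ c := Nat.pow_le_pow_left (base_le k m t hk) c
        _ = 2 ^ (2 * c * m) * (t + 2) ^ c := by rw [mul_pow, ← pow_mul, show 2 * m * c = 2 * c * m by ring])
  have hk2 : k + 2 ≤ 2 ^ m * (t + 2) ^ 2 := by
    have h1' : 1 ≤ 2 ^ m := Nat.one_le_two_pow
    have h4 : 4 ≤ (t + 2) ^ 2 :=
      calc 4 = 2 ^ 2 := rfl
        _ ≤ (t + 2) ^ 2 := Nat.pow_le_pow_left (by omega) 2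
    calc k + 2 ≤ 2 ^ m * 4 := by omega
      _ ≤ 2 ^ m * (t + 2) ^ 2 := Nat.mul_le_mul_left _ h4
  have hkb : (k + 2) ^ b ≤ 2 ^ (b * m) * (t + 2) ^ (2 * b) := by
    calc (k + 2) ^ b ≤ (2 ^ m * (t + 2) ^ 2) ^ b := Nat.pow_le_pow_left hk2 b
      _ = 2 ^ (b * m) * (t + 2) ^ (2 * b) := by rw [mul_pow, ← pow_mul, ← pow_mul, Nat.mul_comm m b]
  calc _ ≤ 𝔅.card * (2 ^ (a * m) * (k + 2) ^ b) := h2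
    _ ≤ (2 ^ (2 * c * m) * (t + 2) ^ c) * (2 ^ (a * m) * (2 ^ (b * m) * (t + 2) ^ (2 * b))) :=
        Nat.mul_le_mul hB (Nat.mul_le_mul_left _ hkb)
    _ = 2 ^ ((2 * c + a + b) * m) * (t + 2) ^ (c + 2 * b) := by ring

/-- The rung and its kernel are equivalent. -/
theorem dissociatedFewProducts_iff_kLetterWeak : DissociatedFewProducts ↔ KLetterWeak :=
  ⟨kLetterWeak_of_dfp, dfp_of_kLetterWeak⟩


/-! ## REGISTERED STUBS and the composition -/

/-- **Registered stub 1 — `KLetterWeak`, THE RUNG'S KERNEL (open, load-bearing).**  Dissociated frames with `≤ k`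
letters per coordinate and `k ≤ 2^m` products: `#vert ≤ 2^(a m)(k+2)^b`.  Known: `2^O(m log m)` (Theorem Q);
poly on the general-position stratum (`dissociated_generic`, Theorems/NewtonUnitEquationsDissociatedUniformGeneric); open exactly on design-like (rank-deficient)
configurations with `log k ≍ m`.  Why plausibly true: every kernel normal form of 5905 (window / cell / coin, leads
c3–c8) measured linear-type growth; why it might fail: a design family with `2^Ω(m log m)` hull vertices at `k = 2^m`
(none known; Carstensen-type `n^Ω(log n)` parametric gadgets do not embed in abelian designs, 5905 NOTES-c8 J4). -/
theorem stub_kLetterWeak :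
    ∃ a b : ℕ, ∀ (k m : ℕ) (A : Fin m → Finset (Fin 2 →₀ ℕ)) (f : Fin k → Fin m → MvPolynomial (Fin 2) ℂ),
      k ≤ 2 ^ m → (∀ j, (A j).card ≤ k) → (∀ i j, (f i j).support ⊆ A j) →
      (∀ a b : Fin m → (Fin 2 →₀ ℕ), (∀ j, a j ∈ A j) → (∀ j, b j ∈ A j) → ∑ j, a j = ∑ j, b j → a = b) →
      (Set.extremePoints ℝ (convexHull ℝ ((fun e : Fin 2 →₀ ℕ => fun i : Fin 2 => ((e i : ℕ) : ℝ)) ''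
        ((∑ i, ∏ j, f i j).support : Set (Fin 2 →₀ ℕ))))).ncard ≤ 2 ^ (a * m) * (k + 2) ^ b := by
  sorry

/-- **Registered stub 2 — `CollisionTransfer`, THE LIMIT STEP (open, hard; no mechanism claimed).**  The dissociated
few-products bound implies the few-products bound for arbitrary supports: coinciding subset sums (cancellation inside
the fibres of the sum map) do not create more than `2^O(m) poly(t)` hull vertices.  Why it might fail: it is the
whole coincidence half of KPTT Conjecture 1 (arXiv:1308.2286 §2, "cancellations ... the main difficulty"); census r1
D-M of crux 5904: the naive simulation of a general frame by a dissociated one is false.  Evidence it is not empty: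
for weighted level sets (no coefficients) dissociation is free (`stub_refineDissociate`, landed, line
binomial-normal-form of 5904). -/
theorem stub_collisionTransfer :
    (∃ a b : ℕ, ∀ (k m t : ℕ) (A : Fin m → Finset (Fin 2 →₀ ℕ)) (f : Fin k → Fin m → MvPolynomial (Fin 2) ℂ),
      k ≤ 2 ^ m → (∀ j, (A j).card ≤ t) → (∀ i j, (f i j).support ⊆ A j) →
      (∀ a b : Fin m → (Fin 2 →₀ ℕ), (∀ j, a j ∈ A j) → (∀ j, b j ∈ A j) → ∑ j, a j = ∑ j, b j → a = b) →
      (Set.extremePoints ℝ (convexHull ℝ ((fun e : Fin 2 →₀ ℕ => fun i : Fin 2 => ((e i : ℕ) : ℝ)) ''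
        ((∑ i, ∏ j, f i j).support : Set (Fin 2 →₀ ℕ))))).ncard ≤ 2 ^ (a * m) * (t + 2) ^ b) →
    Summit.ValiantsHypothesis.ValiantsHypothesis.Theses.NewtonUnitEquations.FewProductsBound := by
  sorry

/-- **Composition (no sorry).**  Kernel ⟹ rung (`dfp_of_kLetterWeak`, proved) ⟹ crux (limit step). -/
theorem FewProductsBound_of :
    KLetterWeak → (DissociatedFewProducts → Summit.ValiantsHypothesis.ValiantsHypothesis.Theses.NewtonUnitEquations.FewProductsBound) →
    Summit.ValiantsHypothesis.ValiantsHypothesis.Theses.NewtonUnitEquations.FewProductsBound :=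
  fun hK hT => hT (dfp_of_kLetterWeak hK)

/-- The skeleton closes the crux BY NAME from the two registered stubs. -/
theorem FewProductsBound_of_stubs :
    Summit.ValiantsHypothesis.ValiantsHypothesis.Theses.NewtonUnitEquations.FewProductsBound :=
  FewProductsBound_of stub_kLetterWeak stub_collisionTransfer

end Summit.ValiantsHypothesis.ValiantsHypothesis.Cruxes.FewProductsBound.DissociatedWeak
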